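import Summits.QuantumFields.BalabanUV.Beta.D1BFx.GhostLegBlockMass

/-!
# `BalabanUV.Beta.D1BFx.GhostLegBlockMassD1` — road «BF-x» for binder row D1, slot (K), END row `hGrp gN`, «GN-L3» PART 1 (owner ruling ρ-g9-33 (L2)∕(L3),
# an3-g57 §3′): THE SHARP HYPOTHESIS-FREE ENTRY BOUND `|Ggh n a x y| ≤ (cG0 + cSplit)∕n²` AND THE d1 TWIN OF M10 — the block-row |·|-mass of the FIRST
# DIFFERENCE of the scalar ghost leg, `Σ_{t ∈ B(β)} |Ggh (y+e_ρ) t − Ggh y t| ≤ cNear1(a)·n⁻¹·e^{−ghDelta(a)·dist(blk y, β)}`, n-FREE constants (corollaries of the tree's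
# hypothesis-free `GhostLegFree.ghost_h0` ∕ `ghost_d1`, leaf-07-g3 p214847)

HONEST DEPENDENCY (cell records, verbatim): «continuum YM on T⁴ ⇐ BetaPertH ∧ nine spine estimates (0/9 proved); BetaPertH ⇐ (D1) ∧ (D4) ∧
CAP+tail; G-an2-4 gates asym, D1 and NE2/3/4.»  HONEST FRAMING (cell contract, verbatim): «discharging `BetaPertH` makes Bałaban's UV stability
UNCONDITIONAL — a real constructive-QFT result; it is NOT the continuum limit and NOT the Clay problem.»  THIS MODULE DISCHARGES NOTHING of the wall:
it is a [folklore] block summation of the tree's pointwise rows `GhostLegFree.ghost_h0` (`|n²·Ggh (b+v) b − gFree v| ≤ cSplit∕n²`, EVERY `v`) and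
`ghost_d1` (`|n²·Ggh (b+v+e_ρ) b − n²·Ggh (b+v) b| ≤ ghA1·e^{−(ghDelta∕n)|v|_∞}∕|v|_∞³`, `v ≠ 0`) with `PointColumnSplit.abs_G₀_le_const`, the block geometry
`B6QGQDecay237.dist_blk_ge` ∕ `card_B`, `GhostLegFree.natAbs_sub_le_blk`, the cube sum `PoissonInterior.sum_cube_inv_nrm_pow_le` (`p = 3`: `Σ_{|z|_∞ ≤ R} nrm z⁻³ ≤ 1 + 216R`)
and `GhostLegBlockMass.dist_eq_supNorm`.  ONE definition with body (the n-free constant `cNear1`), no `def … : Prop`, nothing cited, 0 sorry.  Asserts nothing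
beyond what `ghost_h0`∕`ghost_d1` prove.  Root-level binders hW ∕ hR-sockets ∕ hSX-socket ∕ D1Tel ∕ D1Rep — 0 discharged; (K) NOT closed; NOT D1, NOT `BetaPertH`,
NOT continuum, NOT Clay.

ABSOLUTE RULE (cell charter, verbatim): «No internally-minted statement may enter as a cited fact. Every hypothesis is either kernel-proved in this
package or a verbatim quotation of a PUBLISHED theorem with page reference. The manuscript(s) under audit are NOT citable for their own disputed
steps — they are the thing under adjudication; programme-internal (2001/route/tribunal) claims are never citable.»

WHY (owner d1-p2-g9 ruling ρ-g9-33 on an3-g57 [AN3-G57-N36] §3′: the gluon needle rows T₁∕T₂∕T₃ are n⁰ by ABSOLUTE letters at true scaling; required letters (L2) «the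
R-column envelope `n⁻²·nrm⁻²` (`GhostLegFree.ghost_h0∕d0∕d1` + M10)», (L3) «NEEDLE-POTENTIAL PROFILE for `row_u` — first refusal gan24-leaf-05»; an3 §3′ (2): the
R-column's first differences need «the d1-block-mass `Σ_{z∈B}|Ggh(z,s+e)−Ggh(z,s)| ≤ k∕n`, M10-class» — NOT in the tree; and every sup placement of U-1's counts
uses `GhostLeg.bdd_Ggh = 2∕min 2 a`, which is n² above the truth `Ggh = n⁻²·(gFree + O(n⁻²))`).  THIS FILE supplies the d1 block mass (and, in passing, the sharp
sup); PART 2 (`NeedlePotentialLetters`) builds the R-column masses `m_ρ`, `m′_ρ` and the needle-potential masses `m_row(u) ≤ w_u·m_ρ`, `m′_row(u) ≤ w_u·m′_ρ` on them.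

CONTENT (all [folklore]; `B = B6QGQLower276.B (n − 1)`, `blk = blk (n − 1)`; block side `n` (`[NeZero n]`), `0 < a`).
* §1 **`abs_Ggh_le_sharp`** (`|Ggh n a x y| ≤ (cG0 4 + cSplit 4 a)∕n²`, EVERY `x y`), `ghA1_nonneg`, **`abs_Ggh_diff_le_of_ne`** (`ghost_d1` read at base `t`, offset `y − t`).
* §2 [our object] `cNear1 a := (2·(cG0 4 + cSplit 4 a) + 433·ghA1 a)·e^{2·ghDelta a}`; **`sum_B_abs_Ggh_diff_le`** — the d1 block-ROW mass (FAR `dist ≥ 2`: `n⁴` terms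
  `≤ ghA1·e^{δ}e^{−δD}∕(n²·n³)`; NEAR: the diagonal pair by §1, the rest `(ghA1∕n²)·Σ_{cube(2n)} nrm⁻³ ≤ ghA1·(n⁻² + 432∕n)`), and the column twin **`sum_B_abs_Ggh_diff_col_le`** (`Ggh_symm`).
Unit `b2b-balaban-gan24-formalise-leaf-05` (gen 41), G-an2-4 swarm leaf prover on cross-lane kernel duty; `LEAVES-BFx.md` row (N) ∕ «GN-L3» PART 1.
-/

namespace Summit.QuantumFields.BalabanUV.Beta.D1BFx.GhostLegBlockMassD1

open Finset Real
open Literature.MathematicalPhysics.QuantumFieldTheory.Balaban1983to89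
open Literature.MathematicalPhysics.QuantumFieldTheory.Balaban1983to89.Beta
open B6QGQLower276 (X e blk B mem_B)
open B6QGQDecay237 (deltaU deltaU_pos dist_blk_ge card_B)
open Beta.PoissonInterior (nrm one_le_nrm nrm_pos supNorm_eq_zero_iff cube mem_cube_zero_iff sum_cube_inv_nrm_pow_le)
open DyadicShell (Pt supNorm)
open AffineAveraging (unitVec)
open Summit.QuantumFields.BalabanUV.Beta.D1BFx.GhostLeg (Ggh Ggh_symm cast_pred_add_one)
open Summit.QuantumFields.BalabanUV.Beta.D1BFx.PointColumnSplit (cG0 cG0_nonneg cSplit cSplit_nonneg abs_G₀_le_const)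
open Summit.QuantumFields.BalabanUV.Beta.D1BFx.GhostLegFree (ghA1 ghDelta ghDelta_pos ghost_h0 ghost_d1 natAbs_sub_le_blk supNorm_eq nrm_eq_supNorm)
open Summit.QuantumFields.BalabanUV.Beta.D1BFx.GhostLegBlockMass (dist_eq_supNorm)

noncomputable section

variable (n : ℕ) [NeZero n] {a : ℝ}

/-! ## §1 The sharp entry bound and the pointwise first-difference row -/

/-- [folklore] **THE SHARP, HYPOTHESIS-FREE ENTRY BOUND OF THE GHOST LEG**: `|Ggh n a x y| ≤ (cG0 4 + cSplit 4 a)∕n²` for EVERY `x y` — `GhostLegFree.ghost_h0` (all offsets,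
incl. the diagonal) + the free leg's bound `PointColumnSplit.abs_G₀_le_const`; the tree's `GhostLeg.abs_Ggh_le`∕`bdd_Ggh` (`2∕min 2 a`) sit `n²` above it. -/
theorem abs_Ggh_le_sharp (ha : 0 < a) (x y : Pt) : |Ggh n a x y () ()| ≤ (cG0 4 + cSplit 4 a) / (n : ℝ) ^ 2 := by
  have hn : (0 : ℝ) < n := by exact_mod_cast Nat.pos_of_ne_zero (NeZero.ne n)
  have hn2 : (0 : ℝ) < (n : ℝ) ^ 2 := pow_pos hn 2
  have hn1 : (1 : ℝ) ≤ (n : ℝ) ^ 2 := one_le_pow₀ (by exact_mod_cast NeZero.one_le)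
  have h0 := ghost_h0 n ha y (x - y)
  rw [add_sub_cancel] at h0
  have hG := abs_G₀_le_const (d := 4) (by norm_num) (x - y)
  have hS := cSplit_nonneg 4 ha
  have h1 : |(n : ℝ) ^ 2 * Ggh n a x y () ()| ≤ cG0 4 + cSplit 4 a := by
    have h2 := abs_sub_abs_le_abs_sub ((n : ℝ) ^ 2 * Ggh n a x y () ()) (GhostTable.gFree (x - y))
    have h3 : cSplit 4 a / (n : ℝ) ^ 2 ≤ cSplit 4 a := div_le_self hS hn1
    have h4 : |GhostTable.gFree (x - y)| ≤ cG0 4 := hG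
    linarith
  rw [abs_mul, abs_of_pos hn2] at h1
  rw [le_div_iff₀ hn2]
  linarith

/-- [folklore] `ghA1 a ≥ 0` (read off `ghost_d1` at block size `1`, offset `(1,1,1,1)`). -/
theorem ghA1_nonneg (ha : 0 < a) : 0 ≤ ghA1 a := by
  set v : Pt := fun _ => (1 : ℤ) with hvdef
  have hv : v ≠ 0 := by
    intro h
    have := congr_fun h 0
    rw [hvdef] at this
    norm_num at this
  have h := ghost_d1 1 ha 0 v hv 0
  have hE : 0 < Real.exp (-(ghDelta a / (1 : ℕ)) * supNorm v) := Real.exp_pos _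
  have hN : (0 : ℝ) < (supNorm v : ℝ) ^ 3 := by
    have : 0 < DyadicShell.supNorm v := DyadicShell.supNorm_pos hv
    positivity
  have h0 : 0 ≤ ghA1 a * Real.exp (-(ghDelta a / (1 : ℕ)) * supNorm v) / (supNorm v : ℝ) ^ 3 := (abs_nonneg _).trans h
  rw [le_div_iff₀ hN, zero_mul] at h0
  nlinarith

/-- [folklore] **THE FIRST DIFFERENCE, POINTWISE**: for `t ≠ y`,
`|Ggh (y+e_ρ) t − Ggh y t| ≤ ghA1 a·e^{−(ghDelta a∕n)·|y−t|_∞} ∕ (n²·|y−t|_∞³)` (`ghost_d1` at base point `t`, offset `y − t`). -/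
theorem abs_Ggh_diff_le_of_ne (ha : 0 < a) {y t : Pt} (hyt : y ≠ t) (ρ : Fin 4) :
    |Ggh n a (y + unitVec ρ) t () () - Ggh n a y t () ()|
      ≤ ghA1 a * Real.exp (-(ghDelta a / n) * supNorm (y - t)) / ((n : ℝ) ^ 2 * (supNorm (y - t) : ℝ) ^ 3) := by
  have hn : (0 : ℝ) < n := by exact_mod_cast Nat.pos_of_ne_zero (NeZero.ne n)
  have hv : y - t ≠ 0 := sub_ne_zero.2 hyt
  have h := ghost_d1 n ha t (y - t) hv ρ
  rw [show BubbleTransfer.unitVec ρ = unitVec ρ from rfl] at h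
  have e1 : t + (y - t + unitVec ρ) = y + unitVec ρ := by abel
  have e2 : t + (y - t) = y := by abel
  rw [e1, e2, ← mul_sub, abs_mul, abs_of_pos (pow_pos hn 2)] at h
  have hN : (0 : ℝ) < (supNorm (y - t) : ℝ) := by
    have : 0 < DyadicShell.supNorm (y - t) := DyadicShell.supNorm_pos hv
    exact_mod_cast this
  rw [le_div_iff₀ (pow_pos hN 3)] at h
  rw [le_div_iff₀ (by positivity)]
  calc |Ggh n a (y + unitVec ρ) t () () - Ggh n a y t () ()| * ((n : ℝ) ^ 2 * (supNorm (y - t) : ℝ) ^ 3)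
      = (n : ℝ) ^ 2 * |Ggh n a (y + unitVec ρ) t () () - Ggh n a y t () ()| * (supNorm (y - t) : ℝ) ^ 3 := by ring
    _ ≤ ghA1 a * Real.exp (-(ghDelta a / n) * supNorm (y - t)) := h

/-! ## §2 The d1 block-row mass, n-free × n⁻¹ -/

/-- [our object] **The d1 block-mass constant** `cNear1 a := (2·(cG0 4 + cSplit 4 a) + 433·ghA1 a)·e^{2·ghDelta a}` — n-FREE. -/
def cNear1 (a : ℝ) : ℝ := (2 * (cG0 4 + cSplit 4 a) + 433 * ghA1 a) * Real.exp (2 * ghDelta a)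

/-- [folklore] **M10-d1 — THE BLOCK-ROW |·|-MASS OF THE FIRST DIFFERENCE OF THE SCALAR GHOST LEG**:
`Σ_{t ∈ B (n−1) β} |Ggh n a (y + e_ρ) t − Ggh n a y t| ≤ cNear1 a ∕ n · e^{−ghDelta a · dist (blk (n−1) y) β}` for every `n ≥ 1`, `a > 0`, `y`, `β`, `ρ`. -/
theorem sum_B_abs_Ggh_diff_le (ha : 0 < a) (y β : Pt) (ρ : Fin 4) :
    ∑ t ∈ B (n - 1) β, |Ggh n a (y + unitVec ρ) t () () - Ggh n a y t () ()|
      ≤ cNear1 a / n * Real.exp (-(ghDelta a * dist (blk (n - 1) y) β)) := by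
  have hn : (0 : ℝ) < n := by exact_mod_cast Nat.pos_of_ne_zero (NeZero.ne n)
  have hn1 : (1 : ℝ) ≤ n := by exact_mod_cast NeZero.one_le
  set m : ℕ := n - 1 with hm
  have hmn : ((m : ℝ) + 1) = n := cast_pred_add_one n
  set δ := ghDelta a with hδ
  have hδ0 : 0 < δ := ghDelta_pos ha
  have hA1 : 0 ≤ ghA1 a := ghA1_nonneg ha
  have hC0 : 0 ≤ cG0 4 + cSplit 4 a := add_nonneg (cG0_nonneg 4) (cSplit_nonneg 4 ha)
  set D : ℝ := dist (blk m y) β with hD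
  have hD0 : 0 ≤ D := dist_nonneg
  have hy : y ∈ B m (blk m y) := mem_B.2 rfl
  -- the sharp diagonal pair
  have hdiag : |Ggh n a (y + unitVec ρ) y () () - Ggh n a y y () ()| ≤ 2 * (cG0 4 + cSplit 4 a) / n := by
    have h1 := abs_Ggh_le_sharp n ha (y + unitVec ρ) y
    have h2 := abs_Ggh_le_sharp n ha y y
    have h3 : (cG0 4 + cSplit 4 a) / (n : ℝ) ^ 2 ≤ (cG0 4 + cSplit 4 a) / n :=
      div_le_div_of_nonneg_left hC0 hn (by nlinarith)
    calc _ ≤ |Ggh n a (y + unitVec ρ) y () ()| + |Ggh n a y y () ()| := abs_sub _ _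
      _ ≤ 2 * (cG0 4 + cSplit 4 a) / n := by rw [mul_div_assoc]; linarith
  -- lower bound on the site distance from the block distance
  have hlow : ∀ t ∈ B m β, (n : ℝ) * D - m ≤ (supNorm (y - t) : ℝ) := by
    intro t ht
    have h := dist_blk_ge hy ht
    rw [hmn] at h
    rw [dist_eq_supNorm y t] at h
    exact h
  have hmle : (m : ℝ) ≤ n - 1 := by linarith
  by_cases hfar : 2 ≤ D
  · -- FAR blocks: every term ≤ ghA1·e^{δ}·e^{−δD}/n⁵, and there are n⁴ terms
    have hterm : ∀ t ∈ B m β, |Ggh n a (y + unitVec ρ) t () () - Ggh n a y t () ()| ≤ ghA1 a * Real.exp δ * Real.exp (-(δ * D)) / (n : ℝ) ^ 5 := by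
      intro t ht
      have hN := hlow t ht
      have hNn : (n : ℝ) + 1 ≤ (supNorm (y - t) : ℝ) := by nlinarith
      have hyt : y ≠ t := by
        intro h
        rw [h, sub_self] at hNn
        have : (supNorm (0 : Pt) : ℝ) = 0 := by
          rw [supNorm_eq]; exact_mod_cast (supNorm_eq_zero_iff.2 rfl)
        linarith
      have h1 := abs_Ggh_diff_le_of_ne n ha hyt ρ
      refine h1.trans ?_
      have hNpos : (0 : ℝ) < (supNorm (y - t) : ℝ) := by linarith
      rw [div_le_div_iff₀ (by positivity) (by positivity)]
      have hexp : Real.exp (-(ghDelta a / n) * supNorm (y - t)) ≤ Real.exp δ * Real.exp (-(δ * D)) := by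
        rw [← Real.exp_add]
        apply Real.exp_le_exp.2
        rw [← hδ]
        have : δ / n * ((n : ℝ) * D - m) ≤ δ / n * (supNorm (y - t) : ℝ) :=
          mul_le_mul_of_nonneg_left hN (div_nonneg hδ0.le hn.le)
        have e2 : δ / n * ((n : ℝ) * D - m) = δ * D - δ * (m / n) := by field_simp
        have e3 : δ * ((m : ℝ) / n) ≤ δ := by
          have : (m : ℝ) / n ≤ 1 := by rw [div_le_one hn]; linarith
          nlinarith
        nlinarith
      have hpoly : (n : ℝ) ^ 5 ≤ (n : ℝ) ^ 2 * (supNorm (y - t) : ℝ) ^ 3 := by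
        have : (n : ℝ) ≤ (supNorm (y - t) : ℝ) := by linarith
        have h3 : (n : ℝ) ^ 3 ≤ (supNorm (y - t) : ℝ) ^ 3 := pow_le_pow_left₀ hn.le this 3
        nlinarith [pow_pos hn 2]
      calc ghA1 a * Real.exp (-(ghDelta a / n) * supNorm (y - t)) * (n : ℝ) ^ 5
          ≤ ghA1 a * (Real.exp δ * Real.exp (-(δ * D))) * ((n : ℝ) ^ 2 * (supNorm (y - t) : ℝ) ^ 3) := by
            apply mul_le_mul (mul_le_mul_of_nonneg_left hexp hA1) hpoly (by positivity) (by positivity)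
        _ = ghA1 a * Real.exp δ * Real.exp (-(δ * D)) * ((n : ℝ) ^ 2 * (supNorm (y - t) : ℝ) ^ 3) := by ring
    calc ∑ t ∈ B m β, |Ggh n a (y + unitVec ρ) t () () - Ggh n a y t () ()|
        ≤ ∑ _t ∈ B m β, ghA1 a * Real.exp δ * Real.exp (-(δ * D)) / (n : ℝ) ^ 5 := Finset.sum_le_sum hterm
      _ = ((m : ℝ) + 1) ^ 4 * (ghA1 a * Real.exp δ * Real.exp (-(δ * D)) / (n : ℝ) ^ 5) := by
          rw [Finset.sum_const, nsmul_eq_mul, card_B]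
      _ = ghA1 a * Real.exp δ / n * Real.exp (-(δ * D)) := by rw [hmn]; field_simp
      _ ≤ cNear1 a / n * Real.exp (-(δ * D)) := by
          apply mul_le_mul_of_nonneg_right _ (Real.exp_pos _).le
          apply div_le_div_of_nonneg_right _ hn.le
          unfold cNear1
          rw [← hδ]
          have h1 : Real.exp δ ≤ Real.exp (2 * δ) := Real.exp_le_exp.2 (by linarith)
          have h2 : ghA1 a ≤ 2 * (cG0 4 + cSplit 4 a) + 433 * ghA1 a := by linarith
          exact mul_le_mul h2 h1 (Real.exp_pos _).le (by positivity)
  · -- NEAR blocks (D < 2): the diagonal pair + (ghA1/n²)·Σ_{0 < |z|_∞ ≤ 2n} |z|_∞^{-3}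
    push Not at hfar
    have hDi : ∀ i : Fin 4, ((blk m y i - β i).natAbs : ℝ) ≤ 1 := by
      intro i
      have h := dist_le_pi_dist (blk m y) β i
      rw [Int.dist_eq] at h
      have e1 : (((blk m y i - β i).natAbs : ℝ)) = |((blk m y i : ℝ) - (β i : ℝ))| := by
        rw [Nat.cast_natAbs, Int.cast_abs, Int.cast_sub]
      have h2 : ((blk m y i - β i).natAbs : ℝ) < 2 := by rw [e1]; linarith
      have h3 : (blk m y i - β i).natAbs < 2 := by exact_mod_cast h2
      have h4 : (blk m y i - β i).natAbs ≤ 1 := by omega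
      exact_mod_cast h4
    have hcube : ∀ t ∈ B m β, y - t ∈ cube (0 : Pt) (2 * n) := by
      intro t ht
      rw [mem_cube_zero_iff, Beta.PoissonInterior.supNorm, Finset.sup_le_iff]
      intro i _
      have h := natAbs_sub_le_blk m y t i
      rw [mem_B.1 ht, hmn] at h
      have h2 := hDi i
      have h3 : (((y - t) i).natAbs : ℝ) ≤ (n : ℝ) * 1 + m := by nlinarith
      have h4 : (((y - t) i).natAbs : ℝ) ≤ 2 * n := by linarith
      exact_mod_cast h4
    have hsplit : ∑ t ∈ B m β, |Ggh n a (y + unitVec ρ) t () () - Ggh n a y t () ()| ≤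
        2 * (cG0 4 + cSplit 4 a) / n + ∑ t ∈ (B m β).erase y, |Ggh n a (y + unitVec ρ) t () () - Ggh n a y t () ()| := by
      by_cases hyB : y ∈ B m β
      · rw [← Finset.add_sum_erase _ _ hyB]
        linarith [hdiag]
      · rw [Finset.erase_eq_self.2 hyB]
        have : 0 ≤ 2 * (cG0 4 + cSplit 4 a) / n := by positivity
        linarith
    have hoff : ∀ t ∈ (B m β).erase y, |Ggh n a (y + unitVec ρ) t () () - Ggh n a y t () ()| ≤ ghA1 a / (n : ℝ) ^ 2 * (1 / nrm (y - t) ^ 3) := by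
      intro t ht
      rw [Finset.mem_erase] at ht
      have hyt : y ≠ t := fun h => ht.1 h.symm
      have h1 := abs_Ggh_diff_le_of_ne n ha hyt ρ
      refine h1.trans ?_
      have hv : y - t ≠ 0 := sub_ne_zero.2 hyt
      have hnrm : nrm (y - t) = (supNorm (y - t) : ℝ) := nrm_eq_supNorm hv
      have hNpos : (0 : ℝ) < (supNorm (y - t) : ℝ) := by
        have : 0 < DyadicShell.supNorm (y - t) := DyadicShell.supNorm_pos hv
        exact_mod_cast this
      have hexp : Real.exp (-(ghDelta a / n) * supNorm (y - t)) ≤ 1 := by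
        rw [Real.exp_le_one_iff]
        have : 0 ≤ ghDelta a / n * (supNorm (y - t) : ℝ) := by positivity
        linarith
      rw [hnrm]
      rw [div_le_iff₀ (by positivity)]
      calc ghA1 a * Real.exp (-(ghDelta a / n) * supNorm (y - t)) ≤ ghA1 a * 1 := mul_le_mul_of_nonneg_left hexp hA1
        _ = ghA1 a / (n : ℝ) ^ 2 * (1 / (supNorm (y - t) : ℝ) ^ 3) * ((n : ℝ) ^ 2 * (supNorm (y - t) : ℝ) ^ 3) := by field_simp
    have hsumcube : ∑ t ∈ (B m β).erase y, (1 / nrm (y - t) ^ 3) ≤ ∑ z ∈ cube (0 : Pt) (2 * n), 1 / nrm z ^ 3 := by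
      rw [← Finset.sum_image (f := fun z : Pt => 1 / nrm z ^ 3) (s := (B m β).erase y) (g := fun t => y - t)
        (fun t₁ _ t₂ _ h => by simpa using h)]
      apply Finset.sum_le_sum_of_subset_of_nonneg
      · intro z hz
        rw [Finset.mem_image] at hz
        obtain ⟨t, ht, rfl⟩ := hz
        exact hcube t (Finset.mem_of_mem_erase ht)
      · intro z _ _
        have := nrm_pos z
        positivity
    have hcubeval : ∑ z ∈ cube (0 : Pt) (2 * n), 1 / nrm z ^ 3 ≤ 1 + 432 * (n : ℝ) := by
      have h := sum_cube_inv_nrm_pow_le (d := 4) (by norm_num) (2 * n) 3 (by norm_num)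
      refine h.trans (le_of_eq ?_)
      push_cast
      norm_num
      ring
    have hoffsum : ∑ t ∈ (B m β).erase y, |Ggh n a (y + unitVec ρ) t () () - Ggh n a y t () ()| ≤ 433 * ghA1 a / n := by
      calc ∑ t ∈ (B m β).erase y, |Ggh n a (y + unitVec ρ) t () () - Ggh n a y t () ()|
          ≤ ∑ t ∈ (B m β).erase y, ghA1 a / (n : ℝ) ^ 2 * (1 / nrm (y - t) ^ 3) := Finset.sum_le_sum hoff
        _ = ghA1 a / (n : ℝ) ^ 2 * ∑ t ∈ (B m β).erase y, (1 / nrm (y - t) ^ 3) := by rw [Finset.mul_sum]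
        _ ≤ ghA1 a / (n : ℝ) ^ 2 * (1 + 432 * (n : ℝ)) := mul_le_mul_of_nonneg_left (hsumcube.trans hcubeval) (by positivity)
        _ = ghA1 a * (1 / (n : ℝ) ^ 2 + 432 / n) := by field_simp
        _ ≤ ghA1 a * (1 / n + 432 / n) := by
            apply mul_le_mul_of_nonneg_left _ hA1
            have : 1 / (n : ℝ) ^ 2 ≤ 1 / n := one_div_le_one_div_of_le hn (by nlinarith)
            linarith
        _ = 433 * ghA1 a / n := by ring
    have htot : ∑ t ∈ B m β, |Ggh n a (y + unitVec ρ) t () () - Ggh n a y t () ()| ≤ (2 * (cG0 4 + cSplit 4 a) + 433 * ghA1 a) / n := by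
      rw [add_div]; linarith
    refine htot.trans ?_
    unfold cNear1
    rw [← hδ]
    have hexp1 : 1 ≤ Real.exp (2 * δ) * Real.exp (-(δ * D)) := by
      rw [← Real.exp_add, Real.one_le_exp_iff]; nlinarith
    have hpos : 0 ≤ (2 * (cG0 4 + cSplit 4 a) + 433 * ghA1 a) / n := by positivity
    calc (2 * (cG0 4 + cSplit 4 a) + 433 * ghA1 a) / n = (2 * (cG0 4 + cSplit 4 a) + 433 * ghA1 a) / n * 1 := (mul_one _).symm
      _ ≤ (2 * (cG0 4 + cSplit 4 a) + 433 * ghA1 a) / n * (Real.exp (2 * δ) * Real.exp (-(δ * D))) := mul_le_mul_of_nonneg_left hexp1 hpos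
      _ = (2 * (cG0 4 + cSplit 4 a) + 433 * ghA1 a) * Real.exp (2 * δ) / n * Real.exp (-(δ * D)) := by ring

/-- [folklore] **THE COLUMN TWIN** (`Ggh_symm`): `Σ_{x ∈ B(β)} |Ggh x (s+e_ρ) − Ggh x s| ≤ cNear1 a ∕ n · e^{−ghDelta a · dist (blk s) β}` — an3 §3′'s form
«`Σ_{z∈B}|Ggh(z,s+e)−Ggh(z,s)| ≤ k∕n`». -/
theorem sum_B_abs_Ggh_diff_col_le (ha : 0 < a) (s β : Pt) (ρ : Fin 4) :
    ∑ x ∈ B (n - 1) β, |Ggh n a x (s + unitVec ρ) () () - Ggh n a x s () ()|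
      ≤ cNear1 a / n * Real.exp (-(ghDelta a * dist (blk (n - 1) s) β)) := by
  have e : ∑ x ∈ B (n - 1) β, |Ggh n a x (s + unitVec ρ) () () - Ggh n a x s () ()|
      = ∑ x ∈ B (n - 1) β, |Ggh n a (s + unitVec ρ) x () () - Ggh n a s x () ()| :=
    Finset.sum_congr rfl fun x _ => by rw [Ggh_symm n a ha x (s + unitVec ρ) () (), Ggh_symm n a ha x s () ()]
  rw [e]
  exact sum_B_abs_Ggh_diff_le n ha s β ρ

end

end Summit.QuantumFields.BalabanUV.Beta.D1BFx.GhostLegBlockMassD1
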